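import Summits.QuantumFields.GaugeBoot.StrongCouplingCubicSU3
import HarnessLib

/-!
# Strong coupling from the loop equation: the cubic moments of the `SU(3)` plaquette with a reversed spectator (gauge-boot, ADDENDUM 24 part F, file 3/3)

HONEST FRAMING (cell `pub-gaugeboot`, page 1 of every file): the venture produces certified bounds
on lattice expectations at stated coupling, gauge group, dimension and torus size; NOT a mass gap,
NOT a continuum limit, NOT a string tension; NOT Yang–Mills-summit-bearing (barriers
`FixedCouplingUltralocality`, `PerturbativeInvisibility`).  Exact identities and crude explicit `O(β)` bounds on a
finite torus `(ℤ/L)^d`, `L ≥ 2`, every real `β` (tree coupling); no number of the cell's tables is certified here.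

## Content

Companion of `StrongCouplingCubicSU3`: the doubly-wound plaquette `P̃₀·P̃₀` with the REVERSED plaquette `P̃₀⁻¹` as
spectator.  These mixed cubic moments have Haar value `0` for `SU(3)` (triality), and the loop equations give them
with explicit `O(β)` remainders:

* `doublyWound_reverseSpectator_identity_suN` — ★ (`SU(N)`):
  `(N − 1/N)·E[tr U_P² · tr U_P⁻¹] + E[(tr U_P)² tr U_P⁻¹] − E[tr U_P] = −(β/2)ΣΣ E[plaqTerm(P̃₀P̃₀)·tr U_P⁻¹]`;
* `norm_integral_trace_plaqWord_su3_le` (`‖E tr U_P‖ ≤ 9(d−1)|β|/2`), `norm_integral_trace_reverse_sq_su3_le`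
  (`‖E[(tr U_P⁻¹)²]‖ ≤ 243(d−1)|β|/5`);
* ★ `norm_integral_trace_double_mul_trace_reverse_su3_le` — `SU(3)`: `‖E[tr U_P² · tr U_P⁻¹]‖ ≤ 38(d−1)|β|`;
* ★ `norm_integral_trace_sq_mul_trace_reverse_su3_le` — `SU(3)`: `‖E[(tr U_P)² · tr U_P⁻¹]‖ ≤ 136(d−1)|β|`.

References: Yu. Makeenko, *Methods of contemporary gauge theory* (2002) Problem 12.7; M. Creutz, *Quarks, gluons and
lattices* (1983) Ch. 8.  Everything is `[folklore]`.
-/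

noncomputable section

open MeasureTheory Filter Topology NormedSpace
open scoped Matrix.Norms.Frobenius Matrix ComplexConjugate
open Literature.MathematicalPhysics.QuantumFieldTheory Literature.MathematicalPhysics.QuantumLattice
open Summit.QuantumFields.YangMills.Cruxes.CurvatureAmnesia.WardDefect.SchwingerDyson

namespace Summit.QuantumFields.GaugeBoot

namespace StrongCoupling

variable {d L N : ℕ} [NeZero L]

/-! ## The doubly-wound plaquette with the reversed spectator (`SU(N)`) -/

/-- ★ **Doubly-wound plaquette, spectator `P̃₀⁻¹`** (`SU(N)`): with `y' = E[tr hol(P̃₀P̃₀)·tr hol P̃₀⁻¹]`,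
`e₃ = E[(tr hol P̃₀)²·tr hol P̃₀⁻¹]`, `τ = E[tr hol P̃₀]` (the join `hol(P̃₀P̃₀)·hol P̃₀⁻¹ = hol P̃₀`):
`(N − 1/N)·y' + e₃ − τ = −(β/2)ΣΣ E[plaqTerm(P̃₀P̃₀)·tr hol P̃₀⁻¹]`. [folklore] -/
theorem doublyWound_reverseSpectator_identity_suN (hL : (1 : ZMod L) ≠ 0) (β : ℝ) (x : Site d L) {μ ν₀ : Fin d}
    (hμν₀ : μ ≠ ν₀) :
    ((N : ℂ) - 1 / N) * (∫ U, (fundamentalRep (Fin N) (wordHolonomy U x (plaqWord μ ν₀ true ++ plaqWord μ ν₀ true))).trace *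
        (fundamentalRep (Fin N) (wordHolonomy U x (plaqWord μ ν₀ true).reverse)).trace
          ∂(wilsonMeasure (d := d) (L := L) (fundamentalRep (Fin N)) β)) +
      (∫ U, (fundamentalRep (Fin N) (wordHolonomy U x (plaqWord μ ν₀ true))).trace *
        (fundamentalRep (Fin N) (wordHolonomy U x (plaqWord μ ν₀ true))).trace *
        (fundamentalRep (Fin N) (wordHolonomy U x (plaqWord μ ν₀ true).reverse)).trace
          ∂(wilsonMeasure (d := d) (L := L) (fundamentalRep (Fin N)) β)) -
      (∫ U, (fundamentalRep (Fin N) (wordHolonomy U x (plaqWord μ ν₀ true))).trace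
          ∂(wilsonMeasure (d := d) (L := L) (fundamentalRep (Fin N)) β)) =
      -((β / 2 : ℂ) * ∑ ν ∈ Finset.univ.erase μ, ∑ ε : Bool,
        ∫ U, plaqTerm (fundamentalRep (Fin N)) 1 x μ U (plaqWord μ ν₀ true ++ plaqWord μ ν₀ true) ν ε *
          (fundamentalRep (Fin N) (wordHolonomy U x (plaqWord μ ν₀ true).reverse)).trace
            ∂(wilsonMeasure (d := d) (L := L) (fundamentalRep (Fin N)) β)) := by
  have hcl : Word.endpoint x (plaqWord μ ν₀ true ++ plaqWord μ ν₀ true) = x := by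
    rw [Word.endpoint_append, endpoint_plaqWord, endpoint_plaqWord]
  have h := loopEquation₂_specialUnitaryGroup (d := d) (L := L) N β x μ (plaqWord μ ν₀ true ++ plaqWord μ ν₀ true) hcl x
    (plaqWord μ ν₀ true).reverse
  have hi1 : ∀ k, Integrable (fun U : GaugeConfig d L (Matrix.specialUnitaryGroup (Fin N) ℂ) =>
      splitTerm (fundamentalRep (Fin N)) 1 x μ U (plaqWord μ ν₀ true ++ plaqWord μ ν₀ true) k *
        (fundamentalRep (Fin N) (wordHolonomy U x (plaqWord μ ν₀ true).reverse)).trace)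
      (wilsonMeasure (d := d) (L := L) (fundamentalRep (Fin N)) β) :=
    fun k => integrable_of_continuous (fundamentalLatticeRep N) β
      ((continuous_splitTerm (fundamentalLatticeRep N) 1 x μ _ k).mul (continuous_trace_wordHolonomy (fundamentalLatticeRep N) x _))
  have hi2 : ∀ k, Integrable (fun U : GaugeConfig d L (Matrix.specialUnitaryGroup (Fin N) ℂ) =>
      mergeTerm (fundamentalRep (Fin N)) 1 x μ U (plaqWord μ ν₀ true ++ plaqWord μ ν₀ true) x (plaqWord μ ν₀ true).reverse k)
      (wilsonMeasure (d := d) (L := L) (fundamentalRep (Fin N)) β) :=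
    fun k => integrable_of_continuous (fundamentalLatticeRep N) β (continuous_mergeTerm (fundamentalLatticeRep N) 1 x μ _ x _ k)
  rw [← integral_finsetSum _ fun k _ => hi1 k, ← integral_finsetSum _ fun k _ => hi2 k] at h
  simp_rw [← Finset.sum_mul, sum_splitTerm_double (fundamentalRep (Fin N)) hL 1 x hμν₀,
    sum_mergeTerm_spectator_plaqWord_reverse (fundamentalRep (Fin N)) hL 1 x hμν₀] at h
  -- the join: `hol(P̃₀P̃₀) · hol(P̃₀⁻¹) = hol P̃₀`
  have hjoin : ∀ U : GaugeConfig d L (Matrix.specialUnitaryGroup (Fin N) ℂ),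
      (fundamentalRep (Fin N) (wordHolonomy U x (plaqWord μ ν₀ true ++ plaqWord μ ν₀ true)) *
          fundamentalRep (Fin N) (wordHolonomy U x (plaqWord μ ν₀ true).reverse)).trace =
        (fundamentalRep (Fin N) (wordHolonomy U x (plaqWord μ ν₀ true))).trace := fun U => by
    have hrev := wordHolonomy_reverse U x (plaqWord μ ν₀ true)
    rw [endpoint_plaqWord] at hrev
    rw [← map_mul, wordHolonomy_append, endpoint_plaqWord, hrev, mul_assoc, mul_inv_cancel, mul_one]
  simp_rw [hjoin] at h
  have hc : ∀ u : Word d, Continuous fun U : GaugeConfig d L (Matrix.specialUnitaryGroup (Fin N) ℂ) =>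
      (fundamentalRep (Fin N) (wordHolonomy U x u)).trace := fun u => continuous_trace_wordHolonomy (fundamentalLatticeRep N) x u
  have hiY : Integrable (fun U : GaugeConfig d L (Matrix.specialUnitaryGroup (Fin N) ℂ) =>
      (fundamentalRep (Fin N) (wordHolonomy U x (plaqWord μ ν₀ true ++ plaqWord μ ν₀ true))).trace *
        (fundamentalRep (Fin N) (wordHolonomy U x (plaqWord μ ν₀ true).reverse)).trace)
      (wilsonMeasure (d := d) (L := L) (fundamentalRep (Fin N)) β) :=
    integrable_of_continuous (fundamentalLatticeRep N) β ((hc _).mul (hc _))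
  have hiE : Integrable (fun U : GaugeConfig d L (Matrix.specialUnitaryGroup (Fin N) ℂ) =>
      (fundamentalRep (Fin N) (wordHolonomy U x (plaqWord μ ν₀ true))).trace *
        (fundamentalRep (Fin N) (wordHolonomy U x (plaqWord μ ν₀ true))).trace *
        (fundamentalRep (Fin N) (wordHolonomy U x (plaqWord μ ν₀ true).reverse)).trace)
      (wilsonMeasure (d := d) (L := L) (fundamentalRep (Fin N)) β) :=
    integrable_of_continuous (fundamentalLatticeRep N) β (((hc _).mul (hc _)).mul (hc _))
  have hiT : Integrable (fun U : GaugeConfig d L (Matrix.specialUnitaryGroup (Fin N) ℂ) =>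
      (fundamentalRep (Fin N) (wordHolonomy U x (plaqWord μ ν₀ true))).trace)
      (wilsonMeasure (d := d) (L := L) (fundamentalRep (Fin N)) β) := integrable_of_continuous (fundamentalLatticeRep N) β (hc _)
  have e1 : ∀ U : GaugeConfig d L (Matrix.specialUnitaryGroup (Fin N) ℂ),
      (((N : ℂ) - 1 / N) * (fundamentalRep (Fin N) (wordHolonomy U x (plaqWord μ ν₀ true ++ plaqWord μ ν₀ true))).trace +
        ((fundamentalRep (Fin N) (wordHolonomy U x (plaqWord μ ν₀ true))).trace *
            (fundamentalRep (Fin N) (wordHolonomy U x (plaqWord μ ν₀ true))).trace -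
          1 / N * (fundamentalRep (Fin N) (wordHolonomy U x (plaqWord μ ν₀ true ++ plaqWord μ ν₀ true))).trace)) *
        (fundamentalRep (Fin N) (wordHolonomy U x (plaqWord μ ν₀ true).reverse)).trace =
      ((N : ℂ) - 2 / N) * ((fundamentalRep (Fin N) (wordHolonomy U x (plaqWord μ ν₀ true ++ plaqWord μ ν₀ true))).trace *
          (fundamentalRep (Fin N) (wordHolonomy U x (plaqWord μ ν₀ true).reverse)).trace) +
        (fundamentalRep (Fin N) (wordHolonomy U x (plaqWord μ ν₀ true))).trace *
          (fundamentalRep (Fin N) (wordHolonomy U x (plaqWord μ ν₀ true))).trace *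
          (fundamentalRep (Fin N) (wordHolonomy U x (plaqWord μ ν₀ true).reverse)).trace := fun U => by ring
  have e2 : ∀ U : GaugeConfig d L (Matrix.specialUnitaryGroup (Fin N) ℂ),
      -((fundamentalRep (Fin N) (wordHolonomy U x (plaqWord μ ν₀ true))).trace -
        1 / N * ((fundamentalRep (Fin N) (wordHolonomy U x (plaqWord μ ν₀ true ++ plaqWord μ ν₀ true))).trace *
          (fundamentalRep (Fin N) (wordHolonomy U x (plaqWord μ ν₀ true).reverse)).trace)) =
      1 / N * ((fundamentalRep (Fin N) (wordHolonomy U x (plaqWord μ ν₀ true ++ plaqWord μ ν₀ true))).trace *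
          (fundamentalRep (Fin N) (wordHolonomy U x (plaqWord μ ν₀ true).reverse)).trace) -
        (fundamentalRep (Fin N) (wordHolonomy U x (plaqWord μ ν₀ true))).trace := fun U => by ring
  simp_rw [e1, e2] at h
  rw [integral_add (hiY.const_mul _) hiE, integral_const_mul, integral_sub (hiY.const_mul _) hiT, integral_const_mul] at h
  linear_combination h


/-! ## `SU(3)` bounds -/

/-- `‖E[tr U_P]‖ ≤ 9(d−1)|β|/2` for the `SU(3)` plaquette word (one loop-equation step). [folklore] -/
theorem norm_integral_trace_plaqWord_su3_le (hL : (1 : ZMod L) ≠ 0) (β : ℝ) (x : Site d L) {μ ν₀ : Fin d} (hμν₀ : μ ≠ ν₀) :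
    ‖∫ U, (fundamentalRep (Fin 3) (wordHolonomy U x (plaqWord μ ν₀ true))).trace
        ∂(wilsonMeasure (d := d) (L := L) (fundamentalRep (Fin 3)) β)‖ ≤ 9 * ((d : ℝ) - 1) * |β| / 2 := by
  have h := norm_integral_trace_suN_le (d := d) (L := L) (N := 3) (by norm_num) β x μ (plaqWord μ ν₀ true)
    (endpoint_plaqWord x μ ν₀ true)
    (fun U => by simpa using Equipartition.sum_splitTerm_plaqWord (fundamentalRep (Fin 3)) hL 1 x hμν₀ U true)
  refine h.trans (le_of_eq ?_)
  norm_num; ring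

/-- `‖E[tr U_P⁻¹ · tr U_P⁻¹]‖ ≤ 243(d−1)|β|/5` (`SU(3)`; the conjugate of `E[(tr U_P)²]`, bounded in
`StrongCouplingPlaquetteSUNPieces`). [folklore] -/
theorem norm_integral_trace_reverse_sq_su3_le (hL : (1 : ZMod L) ≠ 0) (β : ℝ) (x : Site d L) {μ ν₀ : Fin d} (hμν₀ : μ ≠ ν₀) :
    ‖∫ U, (fundamentalRep (Fin 3) (wordHolonomy U x (plaqWord μ ν₀ true).reverse)).trace *
        (fundamentalRep (Fin 3) (wordHolonomy U x (plaqWord μ ν₀ true).reverse)).trace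
          ∂(wilsonMeasure (d := d) (L := L) (fundamentalRep (Fin 3)) β)‖ ≤ 243 * ((d : ℝ) - 1) * |β| / 5 := by
  have hP : Word.endpoint x (plaqWord μ ν₀ true) = x := endpoint_plaqWord x μ ν₀ true
  have ha := norm_integral_trace_sq_suN_le (d := d) (L := L) (N := 3) le_rfl hL β x hμν₀
  have hconj : ∫ U, (fundamentalRep (Fin 3) (wordHolonomy U x (plaqWord μ ν₀ true).reverse)).trace *
      (fundamentalRep (Fin 3) (wordHolonomy U x (plaqWord μ ν₀ true).reverse)).trace
        ∂(wilsonMeasure (d := d) (L := L) (fundamentalRep (Fin 3)) β) =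
      conj (∫ U, (fundamentalRep (Fin 3) (wordHolonomy U x (plaqWord μ ν₀ true))).trace *
        (fundamentalRep (Fin 3) (wordHolonomy U x (plaqWord μ ν₀ true))).trace
          ∂(wilsonMeasure (d := d) (L := L) (fundamentalRep (Fin 3)) β)) := by
    rw [← integral_conj]
    refine integral_congr_ae (ae_of_all _ fun U => ?_)
    dsimp only
    rw [trace_wordHolonomy_reverse_eq_conj U x _ hP, map_mul]
  rw [hconj, Complex.norm_conj]
  refine ha.trans (le_of_eq ?_)
  norm_num; ring
/-- ★ **`‖E[tr U_P² · tr U_P⁻¹]‖ ≤ 38(d−1)|β|`** (`SU(3)`): from the reverse-spectator identity of the doubly-wound plaquette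
`(8/3)y' + e₃ − τ = O(β)` with `e₃ = y' + 2·E[(tr U_P⁻¹)²]` (Cayley–Hamilton). [folklore] -/
theorem norm_integral_trace_double_mul_trace_reverse_su3_le (hL : (1 : ZMod L) ≠ 0) (β : ℝ) (x : Site d L) {μ ν₀ : Fin d}
    (hμν₀ : μ ≠ ν₀) :
    ‖∫ U, (fundamentalRep (Fin 3) (wordHolonomy U x (plaqWord μ ν₀ true ++ plaqWord μ ν₀ true))).trace *
        (fundamentalRep (Fin 3) (wordHolonomy U x (plaqWord μ ν₀ true).reverse)).trace
          ∂(wilsonMeasure (d := d) (L := L) (fundamentalRep (Fin 3)) β)‖ ≤ 38 * ((d : ℝ) - 1) * |β| := by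
  have hP : Word.endpoint x (plaqWord μ ν₀ true) = x := endpoint_plaqWord x μ ν₀ true
  set t : GaugeConfig d L (Matrix.specialUnitaryGroup (Fin 3) ℂ) → ℂ :=
    fun U => (fundamentalRep (Fin 3) (wordHolonomy U x (plaqWord μ ν₀ true))).trace with ht
  set t' : GaugeConfig d L (Matrix.specialUnitaryGroup (Fin 3) ℂ) → ℂ :=
    fun U => (fundamentalRep (Fin 3) (wordHolonomy U x (plaqWord μ ν₀ true).reverse)).trace with ht'
  have hI := doublyWound_reverseSpectator_identity_suN (d := d) (L := L) (N := 3) hL β x hμν₀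
  have hR5 := norm_sum_sum_integral_plaqTerm_mul_trace_le (d := d) (L := L) (fundamentalLatticeRep 3) β 1 x μ
    (plaqWord μ ν₀ true ++ plaqWord μ ν₀ true) x (plaqWord μ ν₀ true).reverse
  rw [norm_one, show ((fundamentalLatticeRep 3).N : ℝ) = 3 from rfl] at hR5
  have hc : ∀ u : Word d, Continuous fun U : GaugeConfig d L (Matrix.specialUnitaryGroup (Fin 3) ℂ) =>
      (fundamentalRep (Fin 3) (wordHolonomy U x u)).trace := fun u => continuous_trace_wordHolonomy (fundamentalLatticeRep 3) x u
  -- `t·t·t' = tr(P²)·t' + 2 t'·t'`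
  have hNewton : ∀ U : GaugeConfig d L (Matrix.specialUnitaryGroup (Fin 3) ℂ), t U * t U * t' U =
      (fundamentalRep (Fin 3) (wordHolonomy U x (plaqWord μ ν₀ true ++ plaqWord μ ν₀ true))).trace * t' U + 2 * (t' U * t' U) :=
    fun U => by rw [su3_trace_append_self U x _ hP, ht, ht']; ring
  have hiY : Integrable (fun U => (fundamentalRep (Fin 3) (wordHolonomy U x (plaqWord μ ν₀ true ++ plaqWord μ ν₀ true))).trace * t' U)
      (wilsonMeasure (d := d) (L := L) (fundamentalRep (Fin 3)) β) := integrable_of_continuous (fundamentalLatticeRep 3) β ((hc _).mul (hc _))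
  have hiA : Integrable (fun U => t' U * t' U) (wilsonMeasure (d := d) (L := L) (fundamentalRep (Fin 3)) β) :=
    integrable_of_continuous (fundamentalLatticeRep 3) β ((hc _).mul (hc _))
  have he : ∫ U, t U * t U * t' U ∂(wilsonMeasure (d := d) (L := L) (fundamentalRep (Fin 3)) β) =
      (∫ U, (fundamentalRep (Fin 3) (wordHolonomy U x (plaqWord μ ν₀ true ++ plaqWord μ ν₀ true))).trace * t' U
        ∂(wilsonMeasure (d := d) (L := L) (fundamentalRep (Fin 3)) β)) +
        2 * ∫ U, t' U * t' U ∂(wilsonMeasure (d := d) (L := L) (fundamentalRep (Fin 3)) β) := by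
    simp_rw [hNewton]
    rw [integral_add hiY (hiA.const_mul _), integral_const_mul]
  have hτ := norm_integral_trace_plaqWord_su3_le (d := d) (L := L) hL β x hμν₀
  have hā := norm_integral_trace_reverse_sq_su3_le (d := d) (L := L) hL β x hμν₀
  -- `(11/3) y' = R₅ + τ − 2ā`
  have key : (11 / 3 : ℂ) * (∫ U, (fundamentalRep (Fin 3) (wordHolonomy U x (plaqWord μ ν₀ true ++ plaqWord μ ν₀ true))).trace * t' U
      ∂(wilsonMeasure (d := d) (L := L) (fundamentalRep (Fin 3)) β)) =
      -((β / 2 : ℂ) * ∑ ν ∈ Finset.univ.erase μ, ∑ ε : Bool,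
        ∫ U, plaqTerm (fundamentalRep (Fin 3)) 1 x μ U (plaqWord μ ν₀ true ++ plaqWord μ ν₀ true) ν ε * t' U
          ∂(wilsonMeasure (d := d) (L := L) (fundamentalRep (Fin 3)) β)) +
      (∫ U, t U ∂(wilsonMeasure (d := d) (L := L) (fundamentalRep (Fin 3)) β)) -
      2 * ∫ U, t' U * t' U ∂(wilsonMeasure (d := d) (L := L) (fundamentalRep (Fin 3)) β) := by
    rw [← hI, he]
    have hN : ((3 : ℕ) : ℂ) = 3 := by norm_num
    rw [hN]
    ring
  have hn := congrArg (fun z : ℂ => ‖z‖) key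
  have h113 : ‖(11 / 3 : ℂ)‖ = 11 / 3 := by
    rw [show (11 / 3 : ℂ) = ((11 / 3 : ℝ) : ℂ) by push_cast; ring, Complex.norm_real, Real.norm_eq_abs]; norm_num
  simp only [norm_mul, h113] at hn
  have hβ2 : ‖(β / 2 : ℂ)‖ = |β| / 2 := norm_half_ofReal β
  have hR5' := mul_le_mul_of_nonneg_left hR5 (by positivity : (0 : ℝ) ≤ |β| / 2)
  have hbound : 11 / 3 * ‖∫ U, (fundamentalRep (Fin 3) (wordHolonomy U x (plaqWord μ ν₀ true ++ plaqWord μ ν₀ true))).trace * t' U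
      ∂(wilsonMeasure (d := d) (L := L) (fundamentalRep (Fin 3)) β)‖ ≤
      |β| / 2 * (((d : ℝ) - 1) * (2 * (2 * 3 * (1 + 1) * 3))) + 9 * ((d : ℝ) - 1) * |β| / 2 +
        2 * (243 * ((d : ℝ) - 1) * |β| / 5) := by
    rw [hn]
    refine (norm_sub_le _ _).trans (add_le_add ((norm_add_le _ _).trans (add_le_add ?_ hτ)) ?_)
    · rw [norm_neg, norm_mul, hβ2]; exact hR5'
    · rw [norm_mul, Complex.norm_ofNat]; exact mul_le_mul_of_nonneg_left hā (by norm_num)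
  have hd1 : (0 : ℝ) ≤ (d : ℝ) - 1 := sub_one_nonneg_of_axis μ
  nlinarith [abs_nonneg β]

/-- ★ **`‖E[(tr U_P)² · tr U_P⁻¹]‖ ≤ 136(d−1)|β|`** (`SU(3)`; `= E[tr U_P² tr U_P⁻¹] + 2 E[(tr U_P⁻¹)²]`). [folklore] -/
theorem norm_integral_trace_sq_mul_trace_reverse_su3_le (hL : (1 : ZMod L) ≠ 0) (β : ℝ) (x : Site d L) {μ ν₀ : Fin d}
    (hμν₀ : μ ≠ ν₀) :
    ‖∫ U, (fundamentalRep (Fin 3) (wordHolonomy U x (plaqWord μ ν₀ true))).trace *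
        (fundamentalRep (Fin 3) (wordHolonomy U x (plaqWord μ ν₀ true))).trace *
        (fundamentalRep (Fin 3) (wordHolonomy U x (plaqWord μ ν₀ true).reverse)).trace
          ∂(wilsonMeasure (d := d) (L := L) (fundamentalRep (Fin 3)) β)‖ ≤ 136 * ((d : ℝ) - 1) * |β| := by
  have hP : Word.endpoint x (plaqWord μ ν₀ true) = x := endpoint_plaqWord x μ ν₀ true
  have hc : ∀ u : Word d, Continuous fun U : GaugeConfig d L (Matrix.specialUnitaryGroup (Fin 3) ℂ) =>
      (fundamentalRep (Fin 3) (wordHolonomy U x u)).trace := fun u => continuous_trace_wordHolonomy (fundamentalLatticeRep 3) x u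
  have hNewton : ∀ U : GaugeConfig d L (Matrix.specialUnitaryGroup (Fin 3) ℂ),
      (fundamentalRep (Fin 3) (wordHolonomy U x (plaqWord μ ν₀ true))).trace *
          (fundamentalRep (Fin 3) (wordHolonomy U x (plaqWord μ ν₀ true))).trace *
          (fundamentalRep (Fin 3) (wordHolonomy U x (plaqWord μ ν₀ true).reverse)).trace =
      (fundamentalRep (Fin 3) (wordHolonomy U x (plaqWord μ ν₀ true ++ plaqWord μ ν₀ true))).trace *
          (fundamentalRep (Fin 3) (wordHolonomy U x (plaqWord μ ν₀ true).reverse)).trace +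
        2 * ((fundamentalRep (Fin 3) (wordHolonomy U x (plaqWord μ ν₀ true).reverse)).trace *
          (fundamentalRep (Fin 3) (wordHolonomy U x (plaqWord μ ν₀ true).reverse)).trace) := fun U => by
    rw [su3_trace_append_self U x _ hP]; ring
  have hiY : Integrable (fun U => (fundamentalRep (Fin 3) (wordHolonomy U x (plaqWord μ ν₀ true ++ plaqWord μ ν₀ true))).trace *
      (fundamentalRep (Fin 3) (wordHolonomy U x (plaqWord μ ν₀ true).reverse)).trace)
      (wilsonMeasure (d := d) (L := L) (fundamentalRep (Fin 3)) β) := integrable_of_continuous (fundamentalLatticeRep 3) β ((hc _).mul (hc _))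
  have hiA : Integrable (fun U => (fundamentalRep (Fin 3) (wordHolonomy U x (plaqWord μ ν₀ true).reverse)).trace *
      (fundamentalRep (Fin 3) (wordHolonomy U x (plaqWord μ ν₀ true).reverse)).trace)
      (wilsonMeasure (d := d) (L := L) (fundamentalRep (Fin 3)) β) := integrable_of_continuous (fundamentalLatticeRep 3) β ((hc _).mul (hc _))
  simp_rw [hNewton]
  rw [integral_add hiY (hiA.const_mul _), integral_const_mul]
  have h1 := norm_integral_trace_double_mul_trace_reverse_su3_le (d := d) (L := L) hL β x hμν₀
  have h2 := norm_integral_trace_reverse_sq_su3_le (d := d) (L := L) hL β x hμν₀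
  refine (norm_add_le _ _).trans ?_
  rw [norm_mul, Complex.norm_ofNat]
  have hd1 : (0 : ℝ) ≤ (d : ℝ) - 1 := sub_one_nonneg_of_axis μ
  nlinarith [abs_nonneg β]


end StrongCoupling

end Summit.QuantumFields.GaugeBoot

end
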